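import Summits.CriticalPhenomena.PercolationContinuityZ3.Theorems.PercNearOneGluingNoHeavyQuantHighConv
import HarnessLib

/-!
# QUANT lane R8, T-DEC: THE GLUED-PIECE SLICE HOLDS OFF THE BAND — a glued piece `{0: 1−q, r: q(1−g), r+k: qg}` whose block clears the floor by the
# margin `r(1−q)/k` is adjoinable to any SDEC forest law; so the open residue is the thin band `x ≤ qg < x + r(1−q)/k` (arm-1 gen 57, architect)

builds on p205010 (kernel theorem, internal audit signed; external expert review pending)

Support file (`--supports stmt-CriticalPhenomena-4575`), QUANT lane seat prim-quant-arm-1 (gen 57, architect); memo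
`run/shared/lean/prim/quant/prim-quant-arm-1-g57/ARCH-G57.md` §7–§8.  Theorems only; standard axioms, no sorries.

THE GLUED-PIECE SLICE (memo §7; the one law-level statement the node `SiblingStep` owes after ✓ p552692 `sdec_cons_of_okPieces`): `β` SDEC + affordable at `x`,
`t = gate {r, r+k; g} q = {0: 1−q, r: q(1−g), r+k: qg}` with `x ≤ q·g`, affordable ⟹ `SDEC x (B + (r+k)) (β ∗ t)`.  THIS FILE proves it OFF THE BAND: with
`m = q(r + kg) ≥ r`, the three-atom law `t` is the (unique) same-mean mixture of the heavy blob `{0, r+k; m/(r+k)}` (gate `≥ x` by affordability) and the piece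
`{r, r+k; θ}` with `θ = (m − r)/k = qg − r(1−q)/k`; if `x ≤ θ` the piece is heavy-ON-the-floor and `β ∗` it is SDEC by the blob slice + relays
(`sdec_lconv_lconv_relaysBlob`, arm-1 g56 on CW), `β ∗` the blob is SDEC by `sdec_slice'`, and SDEC is convex along same-mean mixtures (`sdec_of_mixture`).
(The light case `m ≤ 2r` is ✓ `sdec_lightPiece`/`sdec_cons_of_tame`; `m < r` is a mixture of two heavy blobs, also tame.)  So the glued-piece slice — hence
(memo §7, numerically) the node — is OPEN exactly in the BAND `x ≤ q·g < x + r(1−q)/k` with `m > 2r`: the sibling whose glued block (nearly) ATTAINS the forest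
floor.  Canonical member: the near-sure glued child `R[q](R²[g])` at `x = qg`.

* `gluedPiece_split` (the pointwise identity `t = w₁·gate δ_{r+k} θ₁ + w₃·{r,r+k;θ₃}` with its weights), **`sdec_gluedPiece_of_margin`**.

HONEST STATUS.  GLUED-PIECE SLICE in the band, `SiblingStep` / `GateStepN` / `LightResidDECOracle` / `FarTreeRow` OPEN; RATE class (log\*) / honest sentence of
`run/shared/lean/prim/quant/README.md` unchanged.  [this work].  Nothing here is cited as a published result.  The gluing rows served
[cite: KozmaNitzan2024, Conjecture 3 (p. 15)]; product measure [cite: Grimmett1999, §1.3 p. 10].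
-/

noncomputable section

open scoped BigOperators

namespace Summit.CriticalPhenomena.PercolationContinuityZ3.Theorems
namespace Quant

open Finset

namespace LawDec

/-- the point mass `δ_K` -/
local notation3 "δ[" K "]" => (fun k : ℕ => if k = (K : ℕ) then (1 : ℝ) else 0)

/-- the two-point law `{lo, lo+K; g}` = `lo` sure relays and a blob of size `K` at gate `g` -/
local notation3 "TPL[" lo ", " K ", " g "]" => lconv lo K δ[lo] (gate δ[K] g)

/-- **the split of the glued piece**: for `0 < q < 1`, `g ≤ 1`, `r, k ≥ 1`, `m = q(r + kg) ≥ r`, with `D = r + k − m > 0`, `w₁ = (1−q)(r+k)/D`,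
`w₃ = qk(1−g)/D`, `θ₁ = m/(r+k)`, `θ₃ = (m − r)/k`: `gate {r,r+k;g} q = w₁·gate δ_{r+k} θ₁ + w₃·{r, r+k; θ₃}` pointwise, `w₁, w₃ ≥ 0`, `w₁ + w₃ = 1`. [this work] -/
theorem gluedPiece_split (q g : ℝ) (r k : ℕ) (hq0 : 0 < q) (hq1 : q < 1) (hg1 : g ≤ 1) (hr : 1 ≤ r) (hk : 1 ≤ k)
    (hmr : (r : ℝ) ≤ q * ((r : ℝ) + k * g)) :
    let m : ℝ := q * ((r : ℝ) + k * g)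
    let D : ℝ := (r : ℝ) + k - m
    let w₁ : ℝ := (1 - q) * ((r : ℝ) + k) / D
    let w₃ : ℝ := q * k * (1 - g) / D
    0 < D ∧ 0 ≤ w₁ ∧ 0 ≤ w₃ ∧ w₁ + w₃ = 1 ∧ 0 ≤ (m - r) / k ∧ (m - r) / k ≤ 1 ∧ 0 ≤ m / ((r : ℝ) + k) ∧ m / ((r : ℝ) + k) ≤ 1 ∧
      ∀ h : ℕ, gate (TPL[r, k, g]) q h = w₁ * gate δ[r + k] (m / ((r : ℝ) + k)) h + w₃ * (TPL[r, k, (m - r) / k]) h := by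
  intro m D w₁ w₃
  have hr1 : (1 : ℝ) ≤ r := by exact_mod_cast hr
  have hk1 : (1 : ℝ) ≤ k := by exact_mod_cast hk
  have hm_le : m ≤ q * ((r : ℝ) + k) := by
    show q * ((r : ℝ) + k * g) ≤ q * ((r : ℝ) + k)
    exact mul_le_mul_of_nonneg_left (by nlinarith) hq0.le
  have hD : 0 < D := by
    show 0 < (r : ℝ) + k - m
    nlinarith
  have hw1 : 0 ≤ w₁ := div_nonneg (mul_nonneg (by linarith) (by linarith)) hD.le
  have hw3 : 0 ≤ w₃ := div_nonneg (mul_nonneg (mul_nonneg hq0.le (by linarith)) (by linarith)) hD.le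
  have hsum : w₁ + w₃ = 1 := by
    show (1 - q) * ((r : ℝ) + k) / D + q * k * (1 - g) / D = 1
    rw [← add_div, div_eq_one_iff_eq hD.ne']
    show (1 - q) * ((r : ℝ) + k) + q * k * (1 - g) = (r : ℝ) + k - q * ((r : ℝ) + k * g)
    ring
  have hk0 : (0 : ℝ) < k := by linarith
  have hrk0 : (0 : ℝ) < (r : ℝ) + k := by linarith
  refine ⟨hD, hw1, hw3, hsum, div_nonneg (by linarith) hk0.le, ?_, div_nonneg (by nlinarith) hrk0.le, ?_, fun h => ?_⟩
  · rw [div_le_one hk0]; nlinarith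
  · rw [div_le_one hrk0]; nlinarith
  -- the three scalar identities behind the split
  have hrk0' : ((r : ℝ) + k) ≠ 0 := hrk0.ne'
  have c0 : w₁ * (1 - m / ((r : ℝ) + k)) = 1 - q := by
    show (1 - q) * ((r : ℝ) + k) / D * (1 - m / ((r : ℝ) + k)) = 1 - q
    rw [show (1 : ℝ) - m / ((r : ℝ) + k) = D / ((r : ℝ) + k) by
      show (1 : ℝ) - m / ((r : ℝ) + k) = ((r : ℝ) + k - m) / ((r : ℝ) + k); field_simp]
    field_simp
  have cr : w₃ * (1 - (m - r) / k) = q * (1 - g) := by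
    show q * k * (1 - g) / D * (1 - (m - r) / k) = q * (1 - g)
    rw [show (1 : ℝ) - (m - r) / k = D / k by
      show (1 : ℝ) - (m - r) / k = ((r : ℝ) + k - m) / k; field_simp; ring]
    field_simp
  have crk : w₁ * (m / ((r : ℝ) + k)) + w₃ * ((m - r) / k) = q * g := by
    show (1 - q) * ((r : ℝ) + k) / D * (m / ((r : ℝ) + k)) + q * k * (1 - g) / D * ((m - r) / k) = q * g
    rw [show (1 - q) * ((r : ℝ) + k) / D * (m / ((r : ℝ) + k)) = (1 - q) * m / D by field_simp,
      show q * k * (1 - g) / D * ((m - r) / k) = q * (1 - g) * (m - r) / D by field_simp, ← add_div,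
      div_eq_iff hD.ne']
    show (1 - q) * (q * ((r : ℝ) + k * g)) + q * (1 - g) * (q * ((r : ℝ) + k * g) - r) = q * g * ((r : ℝ) + k - q * ((r : ℝ) + k * g))
    ring
  -- the pointwise identity on the atoms `0`, `r`, `r + k` (all distinct) and off them
  have hr0 : r ≠ 0 := by omega
  have hrk : r + k ≠ 0 := by omega
  have hrrk : r ≠ r + k := by omega
  simp only [gate_apply, tpLaw_apply]
  split_ifs <;> first
    | (exfalso; omega)
    | linear_combination c0
    | linear_combination (-1 : ℝ) * c0
    | linear_combination cr
    | linear_combination (-1 : ℝ) * cr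
    | linear_combination crk
    | linear_combination (-1 : ℝ) * crk
    | ring

/-- **THE GLUED-PIECE SLICE OFF THE BAND.**  `β` a probability law on `{0..B}`, affordable and SDEC at `0 < x < 1`; a glued piece with gate `0 < q < 1`, block
gate `0 ≤ g ≤ 1`, `r, k ≥ 1`, affordable (`x(r+k) ≤ q(r+kg) =: m`), `m ≥ r`, and the MARGIN `x ≤ (m − r)/k` (`= qg − r(1−q)/k`, i.e. the block clears the floor by
`r(1−q)/k`) ⟹ `SDEC x (B + (r+k)) (β ∗ gate {r,r+k;g} q)`. [this work] -/
theorem sdec_gluedPiece_of_margin {x : ℝ} (hx0 : 0 < x) (hx1 : x < 1) {B : ℕ} {β : ℕ → ℝ} (β0 : ∀ h, 0 ≤ β h)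
    (βM : ∀ h, B < h → β h = 0) (β1 : ∑ h ∈ Finset.range (B + 1), β h = 1)
    (hta : x * (B : ℝ) ≤ ∑ h ∈ Finset.range (B + 1), (h : ℝ) * β h) (hS : SDEC x B β)
    (q g : ℝ) (r k : ℕ) (hq0 : 0 < q) (hq1 : q < 1) (hg0 : 0 ≤ g) (hg1 : g ≤ 1) (hr : 1 ≤ r) (hk : 1 ≤ k)
    (haff : x * ((r : ℝ) + k) ≤ q * ((r : ℝ) + k * g)) (hmr : (r : ℝ) ≤ q * ((r : ℝ) + k * g))
    (hmargin : x ≤ (q * ((r : ℝ) + k * g) - r) / k) :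
    SDEC x (B + (r + k)) (lconv B (r + k) β (gate (TPL[r, k, g]) q)) := by
  obtain ⟨hD, hw1, hw3, hsum, hθ3_0, hθ3_1, hθ1_0, hθ1_1, hsplit⟩ := gluedPiece_split q g r k hq0 hq1 hg1 hr hk hmr
  set m : ℝ := q * ((r : ℝ) + k * g) with hm
  set D : ℝ := (r : ℝ) + k - m with hDdef
  set w₁ : ℝ := (1 - q) * ((r : ℝ) + k) / D with hw₁
  set w₃ : ℝ := q * k * (1 - g) / D with hw₃
  set θ₁ : ℝ := m / ((r : ℝ) + k) with hθ₁
  set θ₃ : ℝ := (m - r) / k with hθ₃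
  set S : ℝ := ∑ h ∈ Finset.range (B + 1), (h : ℝ) * β h with hSdef
  have hk1 : (1 : ℝ) ≤ k := by exact_mod_cast hk
  have hr1 : (1 : ℝ) ≤ r := by exact_mod_cast hr
  have hk0 : (0 : ℝ) < k := by linarith
  have hrk0 : (0 : ℝ) < (r : ℝ) + k := by linarith
  have hxθ1 : x ≤ θ₁ := by rw [hθ₁]; exact (le_div_iff₀ hrk0).2 haff
  -- the two components
  set μ₁ : ℕ → ℝ := lconv B (r + k) β (gate δ[r + k] θ₁) with hμ₁
  set μ₃ : ℕ → ℝ := lconv B (r + k) β (TPL[r, k, θ₃]) with hμ₃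
  have hw13 : 1 - w₁ = w₃ := by linarith
  have hmix : ∀ h, lconv B (r + k) β (gate (TPL[r, k, g]) q) h = w₁ * μ₁ h + (1 - w₁) * μ₃ h := by
    intro h
    have e : gate (TPL[r, k, g]) q = fun i => w₁ * gate δ[r + k] θ₁ i + w₃ * (TPL[r, k, θ₃]) i := funext hsplit
    rw [hw13, e, lconv_lin_right, hμ₁, hμ₃]
  -- component 1: the blob slice
  have h₁ : SDEC x (B + (r + k)) μ₁ := by
    rw [hμ₁, lconv_gate_point_eq_slice B (r + k) β θ₁ βM]
    exact sdec_slice' x θ₁ B (r + k) β hx0 hx1 hxθ1 hθ1_1 β0 βM β1 hta hS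
  -- component 3: the on-floor heavy piece (relays + heavy blob)
  have h₃ : SDEC x (B + (r + k)) μ₃ := by
    have eβ : lconv 0 B δ[0] β = β := funext fun h => lconv_delta_left 0 B β βM h
    have h0B : 0 + B = B := Nat.zero_add B
    have key := sdec_lconv_lconv_relaysBlob (N := 0) (B := B) (lo := r) (K := k) (M := r + k) (α := δ[0]) (β := β)
      hx0 hx1 hmargin hθ3_1 le_rfl (by push_cast; rw [hθ₃, mul_div_cancel₀ _ hk0.ne']; linarith)
      (fun h => by rw [eβ]; exact β0 h) (fun h hh => by rw [eβ]; exact βM h (by omega))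
      (by rw [eβ, h0B]; exact β1) (by rw [eβ, h0B]; exact hta) (by rw [eβ, h0B]; exact hS)
    have eo : lconv 0 (B + (r + k)) δ[0] (lconv B (r + k) β (TPL[r, k, θ₃])) = μ₃ :=
      funext fun h => lconv_delta_left 0 _ _ (fun i hi => lconv_eq_zero _ _ _ _ i hi) h
    rw [eo, Nat.zero_add] at key
    exact key
  -- means: all equal `S + m`
  obtain ⟨p0, pM, p1, pmn, _⟩ := hs_facts r k θ₃ hθ3_0 hθ3_1
  obtain ⟨g0', gM', g1'⟩ := gate_laws (r + k) δ[r + k] θ₁ hθ1_0 hθ1_1 (fun h => by positivity) (fun h hh => if_neg (by omega)) (by simp)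
  have gmn0 : ∑ h ∈ Finset.range (r + k + 1), (h : ℝ) * gate δ[r + k] θ₁ h = θ₁ * (r + k : ℕ) := by
    rw [sum_mul_gate]; simp
  have gmn' : ∑ h ∈ Finset.range (r + k + 1), (h : ℝ) * gate δ[r + k] θ₁ h = m := by
    rw [gmn0, hθ₁]; push_cast; field_simp
  obtain ⟨t0, tM, t1, tmn, _⟩ := hs_facts r k g hg0 hg1
  obtain ⟨q0', qM', q1'⟩ := gate_laws (r + k) (TPL[r, k, g]) q hq0.le hq1.le t0 tM t1
  have qmn : ∑ h ∈ Finset.range (r + k + 1), (h : ℝ) * gate (TPL[r, k, g]) q h = m := by rw [sum_mul_gate, tmn]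
  have hmμ : ∑ h ∈ Finset.range (B + (r + k) + 1), (h : ℝ) * lconv B (r + k) β (gate (TPL[r, k, g]) q) h = S + m := by
    rw [sum_mul_lconv _ _ _ _ β1 q1', qmn]
  have hm₁ : ∑ h ∈ Finset.range (B + (r + k) + 1), (h : ℝ) * μ₁ h = S + m := by
    rw [hμ₁, sum_mul_lconv _ _ _ _ β1 g1', gmn']
  have hm₃ : ∑ h ∈ Finset.range (B + (r + k) + 1), (h : ℝ) * μ₃ h = S + m := by
    rw [hμ₃, sum_mul_lconv _ _ _ _ β1 p1, pmn, hθ₃, mul_div_cancel₀ _ hk0.ne']; ring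
  have hw1' : w₁ ≤ 1 := by linarith
  exact sdec_of_mixture x (B + (r + k)) _ μ₁ μ₃ w₁ hw1 hw1' hmix (by rw [hm₁, hmμ]) (by rw [hm₃, hmμ]) h₁ h₃

end LawDec
end Quant
end Summit.CriticalPhenomena.PercolationContinuityZ3.Theorems
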